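import Summits.FinalStateConjecture.FinalStateConjecture.Theorems.KerrShieldedDataExist.Negative.BentSliceConormal
import Summits.FinalStateConjecture.FinalStateConjecture.Theorems.SwallowTheDatumKerrShieldedDataExistBridgeImmersion
import Summits.FinalStateConjecture.FinalStateConjecture.Theorems.SwallowTheDatumKerrShieldedDataExistBridgeSecondForm
import HarnessLib

/-!
# `KerrShieldedDataExist`, line `plug-the-second-sheet` — the assembly, V: the bent leaf far out

Support file (everything proved; no definitions, no named facts) for stub `stub_assembly` of crux
`stmt-FinalStateConjecture-10055`. Beyond `|y| ≥ 8M` the hard-coded bent height is the Boyer–Lindquist height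
(`T′ = 2M/(r − 2M)`, `Negative.bentSlope_eq_of_ge`), so the pinned graph `ψ = Negative.graph M 0 r₁` is the STATIC
slice `{t_BL = const}` of Schwarzschild there. Reading `ψ` as the radial map with profile `(T, id)` of
`…BridgeRadial` (`graph_repr`, `mfderiv_graph_apply`):

* `bilin_basisVector_mfderiv_graph` — the static Killing field `∂_{t*}` is `g`-orthogonal to `dψ` there (the slope
  relation `−T′ + (2M/r)(1 + T′) = 0`, `static_bentSlope`);
* `spatial_eq_zero_of_normal` — hence EVERY vector normal to `dψ(T_y)` is a multiple of `∂_{t*}` (the normal line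
  of a spacelike hypersurface: subtract the multiple of `∂_{t*}` that makes it tangent, then positivity of
  `ψ^* g` kills it; O'Neill 1983, Ch. 5, Lemma 5.26), in particular so is any unit normal field `N₀`
  (`normal_eq_smul_basisVector`);
* `secondFundamentalForm_graph_eq_zero_of_lt` — therefore the second fundamental form of `ψ` w.r.t. `N₀` VANISHES
  beyond `8M` (time-reflection symmetry about a static slice, `Bridge.secondFundamentalForm_eq_zero_of_static`).

References: O'Neill 1983, Ch. 4, Prop. 4.13 and Ch. 5, Lemma 5.26; Wald 1984, §6.4; Cook 2000, §3.2.2.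
-/

-- the doubled `FinalStateConjecture` path component is the summit/problem naming scheme, not a mistake
set_option linter.dupNamespace false

noncomputable section

open Set Filter Topology TopologicalSpace
open scoped Manifold ContDiff Topology InnerProductSpace
open Literature.Geometry.Lorentzian
open Summit.FinalStateConjecture.FinalStateConjecture.Theorems.KerrShieldedDataExist

namespace Summit.FinalStateConjecture.FinalStateConjecture.Theorems.SwallowTheDatum

namespace Assembly

section LeafFar

variable {M r₁ : ℝ}

/-- **The graph is the radial map with profile `(T, id)`**: `ψ(y) = T(|y|) ∂_{t*} + (|y|/|y|)(0, y)` on the slice.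
[folklore] -/
theorem graph_repr (y : Kerr.slice 0 r₁) :
    ((Negative.graph M 0 r₁ y : Kerr.region 0 r₁) : E4) =
      Negative.bentHeight M 0 ‖(y : E3)‖ • E4.basisVector 0 + (id ‖(y : E3)‖ / ‖(y : E3)‖) • E4.spaceEmbed (y : E3) := by
  have hs : ‖(y : E3)‖ ≠ 0 := norm_ne_zero_iff.2 (Kerr.ne_zero_of_mem_slice_zero y)
  rw [Negative.coe_graph, Kerr.radius_zero_ofTimeSpace, E4.ofTimeSpace_eq_smul_add', id, div_self hs, one_smul]

/-- **The differential of the graph** on a vector: `dψ_y v = (T′⟪y,v⟫/s) ∂_{t*} + ((1·s − s)⟪y,v⟫/s³)(0, y) + (s/s)(0, v)`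
(the radial-map formula with `ϱ = id`; `T′ = Negative.bentSlope`). [folklore] -/
theorem mfderiv_graph_apply (h0 : |(0 : ℝ)| < M) (y : Kerr.slice 0 r₁) (v : E3) :
    mfderiv 𝓘(ℝ, E3) 𝓘(ℝ, E4) (Negative.graph M 0 r₁) y v =
      (Negative.bentSlope M 0 ‖(y : E3)‖ * ‖(y : E3)‖⁻¹ * ⟪(y : E3), v⟫_ℝ) • E4.basisVector 0 +
        (((fun _ : ℝ ↦ (1 : ℝ)) ‖(y : E3)‖ * ‖(y : E3)‖ - id ‖(y : E3)‖) / ‖(y : E3)‖ ^ 3 * ⟪(y : E3), v⟫_ℝ) •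
          E4.spaceEmbed (y : E3) + (id ‖(y : E3)‖ / ‖(y : E3)‖) • E4.spaceEmbed v :=
  Bridge.mfderiv_of_radialMap_apply (τ := Negative.bentHeight M 0) (ϱ := id) (τ' := Negative.bentSlope M 0)
    (ϱ' := fun _ ↦ 1) (Φ := fun z : E3 ↦ Negative.bentHeight M 0 ‖z‖ • E4.basisVector 0 + (id ‖z‖ / ‖z‖) • E4.spaceEmbed z)
    (fun _ ↦ rfl) graph_repr y (Kerr.ne_zero_of_mem_slice_zero y) (Negative.hasDerivAt_bentHeight h0 _)
    (hasDerivAt_id _) v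

/-- The spatial part of `dψ_y v` is `v`. [folklore] -/
theorem spatial_mfderiv_graph (h0 : |(0 : ℝ)| < M) (y : Kerr.slice 0 r₁) (v : E3) :
    E4.spatial (mfderiv 𝓘(ℝ, E3) 𝓘(ℝ, E4) (Negative.graph M 0 r₁) y v) = v := by
  have hs : ‖(y : E3)‖ ≠ 0 := norm_ne_zero_iff.2 (Kerr.ne_zero_of_mem_slice_zero y)
  rw [mfderiv_graph_apply h0 y v, Bridge.spatial_frame, id, div_self hs, one_smul, one_mul, sub_self, zero_div,
    zero_mul, zero_smul, zero_add]

/-- **The static slope relation beyond `8M`**: with `T′ = 2Mr/(r² − 2Mr) = 2M/(r − 2M)` (`Negative.bentSlope_eq_of_ge`),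
`−T′ + (2M/r)(1 + T′) = 0` — the Boyer–Lindquist slice is orthogonal to `∂_{t*}`. [cite: Wald1984, §6.4] -/
theorem static_bentSlope (hM : 0 < M) {s : ℝ} (hs : 8 * M ≤ s) :
    -Negative.bentSlope M 0 s + 2 * M / id s * (1 + Negative.bentSlope M 0 s) = 0 := by
  have hs0 : s ≠ 0 := by intro h; rw [h] at hs; linarith
  have hs2 : s - 2 * M ≠ 0 := by intro h; linarith
  have hΔ : s ^ 2 - 2 * M * s + (0 : ℝ) ^ 2 = s * (s - 2 * M) := by ring
  rw [Negative.bentSlope_eq_of_ge hM hs, hΔ, id]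
  field_simp
  ring

/-- **`∂_{t*}` is `g`-orthogonal to the graph beyond `8M`**: `g(∂_{t*}, dψ_y w) = (⟪y,w⟫/s)(−T′ + (2M/s)(1 + T′)) = 0`.
[cite: Wald1984, §6.4] -/
theorem bilin_basisVector_mfderiv_graph (h0 : |(0 : ℝ)| < M) {y : Kerr.slice 0 r₁} (hy : 8 * M ≤ ‖(y : E3)‖) (w : E3) :
    Kerr.bilin M 0 ((Negative.graph M 0 r₁ y : Kerr.region 0 r₁) : E4) (E4.basisVector 0)
      (mfderiv 𝓘(ℝ, E3) 𝓘(ℝ, E4) (Negative.graph M 0 r₁) y w) = 0 := by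
  have hM : 0 < M := Negative.mass_pos h0
  have hy0 : (y : E3) ≠ 0 := Kerr.ne_zero_of_mem_slice_zero y
  have hs : ‖(y : E3)‖ ≠ 0 := norm_ne_zero_iff.2 hy0
  have hsp : E4.spatial ((Negative.graph M 0 r₁ y : Kerr.region 0 r₁) : E4) = (id ‖(y : E3)‖ / ‖(y : E3)‖) • (y : E3) := by
    rw [graph_repr]; simp
  have hκ : 0 < id ‖(y : E3)‖ / ‖(y : E3)‖ := by rw [id, div_self hs]; exact one_pos
  have hstatic := static_bentSlope hM hy
  have h0' : Kerr.bilin M 0 ((Negative.graph M 0 r₁ y : Kerr.region 0 r₁) : E4)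
      ((1 : ℝ) • E4.basisVector 0 + (0 : ℝ) • E4.spaceEmbed (y : E3) + (0 : ℝ) • E4.spaceEmbed w)
      ((Negative.bentSlope M 0 ‖(y : E3)‖ * ‖(y : E3)‖⁻¹ * ⟪(y : E3), w⟫_ℝ) • E4.basisVector 0 +
        (((fun _ : ℝ ↦ (1 : ℝ)) ‖(y : E3)‖ * ‖(y : E3)‖ - id ‖(y : E3)‖) / ‖(y : E3)‖ ^ 3 * ⟪(y : E3), w⟫_ℝ) •
          E4.spaceEmbed (y : E3) + (id ‖(y : E3)‖ / ‖(y : E3)‖) • E4.spaceEmbed w) = 0 := by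
    rw [Bridge.bilin_frame M hκ hy0 hsp]
    have hr0 : id ‖(y : E3)‖ ≠ 0 := hs
    calc _ = ⟪(y : E3), w⟫_ℝ / ‖(y : E3)‖ *
          (-Negative.bentSlope M 0 ‖(y : E3)‖ + 2 * M / id ‖(y : E3)‖ * (1 + Negative.bentSlope M 0 ‖(y : E3)‖)) := by
          simp only [id]
          field_simp
          ring
      _ = 0 := by rw [hstatic, mul_zero]
  rw [mfderiv_graph_apply h0 y w]
  simpa using h0'

/-- Every vector of `E4` splits as `x⁰ ∂_{t*} + (0, x⃗)`. [folklore] -/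
theorem eq_smul_basisVector_add_spaceEmbed (x : E4) : x = x 0 • E4.basisVector 0 + E4.spaceEmbed (E4.spatial x) := by
  conv_lhs => rw [← E4.ofTimeSpace_time_spatial x]
  rw [E4.ofTimeSpace_eq_smul_add', E4.time_apply]

variable [Kerr.Facts]

/-- **The normal line of the static slice is spanned by `∂_{t*}`.** Beyond `8M`, a vector `n` which is
`g`-orthogonal to `dψ_y(T_y)` has no spatial part: `m = n − (n⁰ − (dψ n⃗)⁰) ∂_{t*}` is the TANGENT vector `dψ_y n⃗`,
and `g(m, m) = g(n, m) − α g(∂_{t*}, m) = 0`, so `n⃗ = 0` by positivity of `ψ^* g`. O'Neill 1983, Ch. 5, Lemma 5.26.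
[cite: ONeill1983, Ch. 5, Lemma 5.26] -/
theorem spatial_eq_zero_of_normal (h0 : |(0 : ℝ)| < M)
    (hsp : (Kerr.smoothMetric M 0 r₁).IsSpacelikeImmersion 𝓘(ℝ, E3) (Negative.graph M 0 r₁))
    {y : Kerr.slice 0 r₁} (hy : 8 * M ≤ ‖(y : E3)‖) {n : E4}
    (hn : ∀ w : E3, Kerr.bilin M 0 ((Negative.graph M 0 r₁ y : Kerr.region 0 r₁) : E4) n
      (mfderiv 𝓘(ℝ, E3) 𝓘(ℝ, E4) (Negative.graph M 0 r₁) y w) = 0) :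
    E4.spatial n = 0 := by
  set x : E4 := ((Negative.graph M 0 r₁ y : Kerr.region 0 r₁) : E4) with hx
  set m : E4 := mfderiv 𝓘(ℝ, E3) 𝓘(ℝ, E4) (Negative.graph M 0 r₁) y (E4.spatial n) with hm
  have hmsp : E4.spatial m = E4.spatial n := spatial_mfderiv_graph h0 y _
  set α : ℝ := n 0 - m 0 with hα
  have hdecomp : n - α • E4.basisVector 0 = m := by
    rw [eq_smul_basisVector_add_spaceEmbed m, hmsp, eq_smul_basisVector_add_spaceEmbed n, hα]
    simp only [map_add, map_smul, E4.spatial_spaceEmbed, Kerr.spatial_basisVector_zero, smul_zero, zero_add]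
    module
  have hgmm : Kerr.bilin M 0 x m m = 0 := by
    have h1 : Kerr.bilin M 0 x (n - α • E4.basisVector 0) m =
        Kerr.bilin M 0 x n m - α * Kerr.bilin M 0 x (E4.basisVector 0) m := by
      simp only [map_sub, map_smul]; rfl
    have h2 : Kerr.bilin M 0 x m m = Kerr.bilin M 0 x (n - α • E4.basisVector 0) m := by rw [hdecomp]
    have hn' : Kerr.bilin M 0 x n m = 0 := hn _
    have he0 : Kerr.bilin M 0 x (E4.basisVector 0) m = 0 := bilin_basisVector_mfderiv_graph h0 hy _
    rw [h2, h1, hn', he0, mul_zero, sub_zero]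
  by_contra hne
  have hpos := hsp.inducedBilin_pos y (v := E4.spatial n) hne
  rw [PseudoRiemannianMetric.inducedBilin_apply] at hpos
  have hpos' : 0 < Kerr.bilin M 0 x m m := hpos
  rw [hgmm] at hpos'
  exact lt_irrefl _ hpos'

variable {N₀ : E3 → E4}

/-- Beyond `8M` a unit normal of the graph is a multiple of `∂_{t*}`: `N₀ y = (N₀ y)⁰ ∂_{t*}`. [cite: ONeill1983, Ch. 5, Lemma 5.26] -/
theorem normal_eq_smul_basisVector (h0 : |(0 : ℝ)| < M)
    (hsp : (Kerr.smoothMetric M 0 r₁).IsSpacelikeImmersion 𝓘(ℝ, E3) (Negative.graph M 0 r₁))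
    (hν : (Kerr.smoothMetric M 0 r₁).IsUnitNormal 𝓘(ℝ, E3) (Negative.graph M 0 r₁) (fun y ↦ N₀ y) (-1))
    {y : Kerr.slice 0 r₁} (hy : 8 * M ≤ ‖(y : E3)‖) : N₀ y = N₀ y 0 • E4.basisVector 0 := by
  have hzero : E4.spatial (N₀ y) = 0 := spatial_eq_zero_of_normal h0 hsp hy fun w ↦ hν.1 y w
  conv_lhs => rw [eq_smul_basisVector_add_spaceEmbed (N₀ y), hzero, map_zero, add_zero]

/-- **Beyond `8M` the second fundamental form of the graph w.r.t. any smooth unit normal field vanishes** (the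
normal is a multiple of the static Killing field `∂_{t*}` near `y`; `Bridge.secondFundamentalForm_eq_zero_of_static`).
[cite: ONeill1983, Ch. 4, Prop. 4.13] -/
theorem secondFundamentalForm_graph_eq_zero_of_lt (h0 : |(0 : ℝ)| < M) [(Kerr.smoothMetric M 0 r₁).HasLeviCivita]
    (hsp : (Kerr.smoothMetric M 0 r₁).IsSpacelikeImmersion 𝓘(ℝ, E3) (Negative.graph M 0 r₁))
    (hν : (Kerr.smoothMetric M 0 r₁).IsUnitNormal 𝓘(ℝ, E3) (Negative.graph M 0 r₁) (fun y ↦ N₀ y) (-1))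
    (hN₀ : ContDiffOn ℝ ∞ N₀ (Kerr.slice 0 r₁ : Set E3))
    {y : Kerr.slice 0 r₁} (hy : 8 * M < ‖(y : E3)‖) (v w : E3) :
    (Kerr.smoothMetric M 0 r₁).secondFundamentalForm 𝓘(ℝ, E3) (Negative.graph M 0 r₁) (fun y ↦ N₀ y) y v w = 0 := by
  have hM : 0 < M := Negative.mass_pos h0
  have hy0 : (y : E3) ≠ 0 := Kerr.ne_zero_of_mem_slice_zero y
  have hNd : DifferentiableAt ℝ N₀ y :=
    (hN₀.differentiableOn (by simp)).differentiableAt ((Kerr.slice 0 r₁).isOpen.mem_nhds y.2)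
  have hNlam : N₀ =ᶠ[𝓝 (y : E3)] fun z ↦ N₀ z 0 • E4.basisVector 0 := by
    have h1 : ∀ᶠ z : E3 in 𝓝 (y : E3), 8 * M < ‖z‖ := continuous_norm.continuousAt.eventually (Ioi_mem_nhds hy)
    have h2 : ∀ᶠ z : E3 in 𝓝 (y : E3), z ∈ Kerr.slice 0 r₁ := (Kerr.slice 0 r₁).isOpen.mem_nhds y.2
    filter_upwards [h1, h2] with z hz hzs
    exact normal_eq_smul_basisVector (y := ⟨z, hzs⟩) h0 hsp hν hz.le
  have hlam : DifferentiableAt ℝ (fun z : E3 ↦ N₀ z 0) y :=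
    (EuclideanSpace.proj (𝕜 := ℝ) (0 : Fin 4)).differentiableAt.comp (y : E3) hNd
  exact Bridge.secondFundamentalForm_eq_zero_of_static (f := Negative.graph M 0 r₁) (ν := fun y ↦ N₀ y)
    (τ := Negative.bentHeight M 0) (ϱ := id)
    (Φ := fun z : E3 ↦ Negative.bentHeight M 0 ‖z‖ • E4.basisVector 0 + (id ‖z‖ / ‖z‖) • E4.spaceEmbed z)
    graph_repr (fun _ ↦ rfl) (fun _ ↦ rfl) hy0 (Negative.hasDerivAt_bentHeight h0 _) (hasDerivAt_id _)
    (by rw [id]; exact norm_pos_iff.2 hy0) (static_bentSlope hM hy.le) hNlam hlam v w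

end LeafFar

end Assembly

/-- **Registered export of this file** (sub-goal `assembly_leafFar` of stub `stub_assembly`): beyond `8M` the second
fundamental form of the bent graph w.r.t. any smooth unit normal vanishes, `Assembly.secondFundamentalForm_graph_eq_zero_of_lt`.
[cite: ONeill1983, Ch. 4, Prop. 4.13] -/
theorem assembly_leafFar :
    ∀ [Kerr.Facts] (M r₁ : ℝ), |(0 : ℝ)| < M → ∀ [(Kerr.smoothMetric M 0 r₁).HasLeviCivita] (N₀ : E3 → E4), (Kerr.smoothMetric M 0 r₁).IsSpacelikeImmersion 𝓘(ℝ, E3) (Negative.graph M 0 r₁) → (Kerr.smoothMetric M 0 r₁).IsUnitNormal 𝓘(ℝ, E3) (Negative.graph M 0 r₁) (fun y ↦ N₀ y) (-1) → ContDiffOn ℝ ∞ N₀ (Kerr.slice 0 r₁ : Set E3) → ∀ (y : Kerr.slice 0 r₁), 8 * M < ‖(y : E3)‖ → ∀ (v w : E3), (Kerr.smoothMetric M 0 r₁).secondFundamentalForm 𝓘(ℝ, E3) (Negative.graph M 0 r₁) (fun y ↦ N₀ y) y v w = 0 :=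
  fun _ _ h0 _ _ hsp hν hN₀ _ hy v w ↦ Assembly.secondFundamentalForm_graph_eq_zero_of_lt h0 hsp hν hN₀ hy v w

end Summit.FinalStateConjecture.FinalStateConjecture.Theorems.SwallowTheDatum

end
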